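import Summits.CriticalPhenomena.PercolationContinuityZ3.Theorems.PercNearOneGluingNoHeavyLowerTailSahiThreeCopySlices
import Summits.CriticalPhenomena.PercolationContinuityZ3.Theorems.PercNearOneGluingNoHeavyLowerTailSahiThreeCopyGadget

/-!
# `NoHeavyLowerTail` (crux stmt-CriticalPhenomena-4575), Sahi programme: **THE IDLE-COORDINATE SLICE OF `c_b`** — how the three-copy
# Sahi coefficient of `(F, G, H)` changes when one coordinate on which `F` does NOT depend is sliced off: three coefficients of mixed
# sections plus ONE correction `Γ_F(δG, δH) = 2N(F·δG·δH;1;1) − N(F;δG·δH;1)` at the (non-monotone) differences `δG = G¹ − G⁰`, `δH = H¹ − H⁰`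

Support file (Sahi cell, seat `prim-sahi-p1`, generation 60; `--supports stmt-CriticalPhenomena-4575`).  Two corollaries of `tc_cons_one` /
`tc_cons_two` (`…SahiThreeCopySlices`) at `δF = 0`; pure proofs, standard axioms.

* `tc_cons_one_idle`: if `F¹ = F⁰` then `c_{(1,b)}(F,G,H) = c_b(F⁰,G⁰,H⁰) + c_b(F⁰,G¹,H⁰) + c_b(F⁰,G⁰,H¹) + Γ_{F⁰}(δG,δH)`;
* `tc_cons_two_idle`: if `F¹ = F⁰` then `c_{(2,b)}(F,G,H) = c_b(F⁰,G¹,H¹) + c_b(F⁰,G¹,H⁰) + c_b(F⁰,G⁰,H¹) + Γ_{F⁰}(δG,δH)`.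
MEANING (memo FROM-prim-sahi-p1-gen60 §8).  With `US_d(f)` := "3C-SAHI for the slot `frontFn f` against all `G, H` on `d` further
coordinates", these identities are the exact passage `US_d → US_{d+1}`: the only possibly negative term is `Γ_F` at the differences of nested
monotone functions (on indicators: the `c`-mass of the 'corner' `(G¹∖G⁰)∩(H¹∖H⁰)`, negative exactly on the non-`f` levels).  The d-uniform
certificates TP₀ (`…TwoPoint`, refuted in general by `…TwoPointRefutation`) and TP₀′ (`…MatrixSandwich`) price such corners at zero, which is
why they can be strictly lossy.  Nothing conjectural is used. [this work]
-/

namespace Summit.CriticalPhenomena.PercolationContinuityZ3.Theorems.SahiThreeCopy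

open Finset Function Literature.Combinatorics.Sahi2008
open scoped BigOperators

noncomputable section

variable {d : ℕ}

/-- ★ **Idle-coordinate slice, profile entry 1.**  If `F` does not depend on coordinate `0` (`F¹ = F⁰`), then
`c_{(1,b)}(F,G,H) = c_b(F⁰,G⁰,H⁰) + c_b(F⁰,G¹,H⁰) + c_b(F⁰,G⁰,H¹) + [2N_b(F⁰·δG·δH;1;1) − N_b(F⁰;δG·δH;1)]`, `δG = G¹ − G⁰`, `δH = H¹ − H⁰`.
[this work] -/
theorem tc_cons_one_idle (b : Fin d → ℕ) (f g h : Pt (d + 1) → ℝ) (hf : sec f true = sec f false) :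
    tc (Fin.cons 1 b : Fin (d + 1) → ℕ) f g h =
      tc b (sec f false) (sec g false) (sec h false) + tc b (sec f false) (sec g true) (sec h false) +
        tc b (sec f false) (sec g false) (sec h true)
      + (2 * N3 b (sec f false * (sec g true - sec g false) * (sec h true - sec h false)) 1 1
          - N3 b (sec f false) ((sec g true - sec g false) * (sec h true - sec h false)) 1) := by
  rw [tc_cons_one, hf]
  simp only [sub_self, zero_mul, mul_zero, N3_zero_left, N3_zero_mid']
  ring

/-- ★ **Idle-coordinate slice, profile entry 2.**  If `F¹ = F⁰`, then
`c_{(2,b)}(F,G,H) = c_b(F⁰,G¹,H¹) + c_b(F⁰,G¹,H⁰) + c_b(F⁰,G⁰,H¹) + [2N_b(F⁰·δG·δH;1;1) − N_b(F⁰;δG·δH;1)]`. [this work] -/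
theorem tc_cons_two_idle (b : Fin d → ℕ) (f g h : Pt (d + 1) → ℝ) (hf : sec f true = sec f false) :
    tc (Fin.cons 2 b : Fin (d + 1) → ℕ) f g h =
      tc b (sec f false) (sec g true) (sec h true) + tc b (sec f false) (sec g true) (sec h false) +
        tc b (sec f false) (sec g false) (sec h true)
      + (2 * N3 b (sec f false * (sec g true - sec g false) * (sec h true - sec h false)) 1 1
          - N3 b (sec f false) ((sec g true - sec g false) * (sec h true - sec h false)) 1) := by
  rw [tc_cons_two, hf]
  simp only [sub_self, zero_mul, mul_zero, N3_zero_left, N3_zero_mid']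
  ring

/-- The correction term is nonnegative when the differences are themselves nonnegative AND monotone (e.g. `G⁰ = 0` or `H⁰ = 0`: the
literal cases), by three-copy Harris; in general it has no sign. [this work] -/
theorem idle_correction_nonneg_of_monotone (b : Fin d → ℕ) {f u v : Pt d → ℝ} (hf : ∀ x, 0 ≤ f x) (hfm : Monotone f)
    (hu : ∀ x, 0 ≤ u x) (hum : Monotone u) (hv : ∀ x, 0 ≤ v x) (hvm : Monotone v) :
    0 ≤ 2 * N3 b (f * u * v) 1 1 - N3 b f (u * v) 1 := by
  have h1 : N3 b f (u * v) 1 ≤ N3 b (f * (u * v)) 1 1 :=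
    N3_le_N3_mul d b f (u * v) 1 hf hfm (fun x => mul_nonneg (hu x) (hv x))
      (fun x y hxy => mul_le_mul (hum hxy) (hvm hxy) (hv x) (hu y)) fun _ => zero_le_one
  have h2 : 0 ≤ N3 b (f * u * v) 1 1 :=
    N3_nonneg b (fun x => mul_nonneg (mul_nonneg (hf x) (hu x)) (hv x)) (fun _ => zero_le_one) fun _ => zero_le_one
  have e : f * (u * v) = f * u * v := by rw [mul_assoc]
  rw [e] at h1
  linarith

end

end Summit.CriticalPhenomena.PercolationContinuityZ3.Theorems.SahiThreeCopy
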